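import Mathlib
import Literature.AlgebraicGeometry.Resolution.CobordantGame
import Literature.AlgebraicGeometry.Resolution.FormalCoordinateChange
import Summits.ResolutionOfSingularities.ResolutionOfSingularities.Theorems.WeightedInvariantLocalWeightedDropMonicRecentre
import Summits.ResolutionOfSingularities.ResolutionOfSingularities.Theorems.WeightedInvariantLocalWeightedDropWildPurePowerSteps

/-!
# `WeightedInvariant.LocalWeightedDrop`, line `hasse-ridge-face-selection`: the TAYLOR SHIFT of a monic form — re-centring
# `y ↦ y + φ(x')` and plane changes are FREE MOVES for `y^d + Σ_{j<d} A_j(x') y^j` in EVERY degree `d`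

Crux item stmt-ResolutionOfSingularities-8899 `LocalWeightedDrop` (route `ResolutionOfSingularities/WeightedInvariant`), engine of
the door `HypersurfaceCentreConstruction` stmt-ResolutionOfSingularities-19897.  [OURS · L1 W4.3, chain w43, res-type-083 (extra
seat S3ρ, CHAIN v4.3 D12): §A of the design memo `L/res-type-083/S3RHO-DESIGN.md` — the API under the descent lift for the GENERAL
monic surface forms (piece S3ρ `stub_wildMonicSurfaceReductionWon` of skeleton v28).  Not a statement of any manuscript.]

* `WildMonic.monicPoly d A = Y^d + Σ_{j<d} A_j Y^j ∈ R[Y]` and the TAYLOR SHIFT `WildMonic.shift d A φ` = the lower coefficients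
  of `taylor φ (monicPoly d A)`, i.e. `shift d A φ j = Σ_{i ≥ j} C(i,j) Â_i φ^{i-j}` (`Â_d = 1`); `taylor_monicPoly`:
  `taylor φ (monicPoly d A) = monicPoly d (shift d A φ)`.
* `subst_shear_monicForm`: the shear `(x', y + φ(x'))`, `φ(0) = 0`, carries the monic form of `A` (= `eval₂` of `monicPoly` at
  `y = X (Fin.last m)`, `eval₂_monicPoly`) to the monic form of `shift d A φ` (via `Polynomial.hom_eval₂` / `eval₂_comp`);
  `won_monic_recentre_iff`: RE-CENTRING IS A FREE MOVE (degree-`2` instance: `won_monic_two_recentre_iff`).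
* `subst_extendLast_monicForm` / `won_monic_substX_iff`: a coordinate change `θ` of the plane `k[[x']]` extended by `y ↦ y`
  acts coefficientwise, `A_j ↦ A_j ∘ θ`, and is a free move (tuple version of `WildPurePower.won_purePower_substX_iff`).
-/

set_option linter.dupNamespace false -- mandated namespace of this single-conjunct summit

namespace Summit.ResolutionOfSingularities.ResolutionOfSingularities.Theorems

open Literature.AlgebraicGeometry.Resolution
open Literature.AlgebraicGeometry.Resolution.CobordantGame

namespace WildMonic

section Shift

variable {R : Type*} [CommRing R]

/-- The monic polynomial `Y^d + Σ_{j<d} A_j Y^j` of a coefficient tuple `A` (in the variable `Y` over the coefficient ring). -/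
noncomputable def monicPoly (d : ℕ) (A : Fin d → R) : Polynomial R :=
  Polynomial.X ^ d + ∑ j : Fin d, Polynomial.C (A j) * Polynomial.X ^ (j : ℕ)

/-- THE TAYLOR SHIFT of a coefficient tuple: the coefficients (below degree `d`) of `(Y+φ)^d + Σ_{j<d} A_j (Y+φ)^j`, i.e.
`shift d A φ j = Σ_{i ≥ j} C(i,j) Â_i φ^{i-j}` with `Â_d = 1` — the tuple of the RE-CENTRED monic form `y ↦ y + φ`. -/
noncomputable def shift (d : ℕ) (A : Fin d → R) (φ : R) : Fin d → R :=
  fun j => (Polynomial.taylor φ (monicPoly d A)).coeff (j : ℕ)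

/-- Coefficients of `monicPoly`: `1` at `Y^d`, `A_j` at `Y^j` (`j < d`), `0` above. -/
theorem coeff_monicPoly (d : ℕ) (A : Fin d → R) (n : ℕ) :
    (monicPoly d A).coeff n = (if n = d then (1 : R) else 0) + ∑ j : Fin d, if n = (j : ℕ) then A j else 0 := by
  classical
  rw [monicPoly, Polynomial.coeff_add, Polynomial.coeff_X_pow, Polynomial.finsetSum_coeff]
  congr 1
  refine Finset.sum_congr rfl fun j _ => ?_
  rw [Polynomial.coeff_C_mul, Polynomial.coeff_X_pow]
  split_ifs <;> simp

/-- The `Y^j`-coefficient of `monicPoly d A` is `A_j` for `j < d`. -/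
theorem coeff_monicPoly_of_lt (d : ℕ) (A : Fin d → R) (j : Fin d) :
    (monicPoly d A).coeff (j : ℕ) = A j := by
  classical
  rw [coeff_monicPoly, if_neg (ne_of_lt j.2), zero_add, Finset.sum_eq_single j]
  · rw [if_pos rfl]
  · intro l _ hl
    rw [if_neg (fun h => hl (Fin.ext h).symm)]
  · intro h
    exact absurd (Finset.mem_univ j) h

/-- The `Y^d`-coefficient of `monicPoly d A` is `1`. -/
theorem coeff_monicPoly_self (d : ℕ) (A : Fin d → R) : (monicPoly d A).coeff d = 1 := by
  classical
  rw [coeff_monicPoly, if_pos rfl, Finset.sum_eq_zero, add_zero]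
  intro j _
  rw [if_neg (ne_of_gt j.2)]

/-- `monicPoly d A` has no coefficients above degree `d`. -/
theorem coeff_monicPoly_of_gt (d : ℕ) (A : Fin d → R) {n : ℕ} (hn : d < n) : (monicPoly d A).coeff n = 0 := by
  classical
  rw [coeff_monicPoly, if_neg (ne_of_gt hn), Finset.sum_eq_zero, add_zero]
  intro j _
  rw [if_neg]
  have := j.2
  omega

/-- `monicPoly d A` has degree `≤ d`. -/
theorem natDegree_monicPoly_le (d : ℕ) (A : Fin d → R) : (monicPoly d A).natDegree ≤ d := by
  rw [Polynomial.natDegree_le_iff_coeff_eq_zero]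
  intro n hn
  exact coeff_monicPoly_of_gt d A (by exact_mod_cast hn)

/-- A polynomial of degree `≤ d` with `Y^d`-coefficient `1` is the monic polynomial of its lower coefficients. -/
theorem eq_monicPoly_of_coeff (d : ℕ) (q : Polynomial R) (hdeg : q.natDegree ≤ d) (hc : q.coeff d = 1) :
    q = monicPoly d (fun j : Fin d => q.coeff (j : ℕ)) := by
  ext n
  rcases Nat.lt_trichotomy n d with hlt | rfl | hgt
  · rw [coeff_monicPoly_of_lt d _ ⟨n, hlt⟩]
  · rw [hc, coeff_monicPoly_self]
  · rw [coeff_monicPoly_of_gt d _ hgt]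
    exact Polynomial.coeff_eq_zero_of_natDegree_lt (lt_of_le_of_lt hdeg hgt)

variable [Nontrivial R]

/-- Over a non-trivial ring `monicPoly d A` has degree exactly `d`. -/
theorem natDegree_monicPoly (d : ℕ) (A : Fin d → R) : (monicPoly d A).natDegree = d :=
  le_antisymm (natDegree_monicPoly_le d A)
    (Polynomial.le_natDegree_of_ne_zero (by rw [coeff_monicPoly_self]; exact one_ne_zero))

/-- RE-CENTRING IN POLYNOMIAL FORM: `taylor φ (Y^d + Σ A_j Y^j) = Y^d + Σ (shift d A φ)_j Y^j`. -/
theorem taylor_monicPoly (d : ℕ) (A : Fin d → R) (φ : R) :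
    Polynomial.taylor φ (monicPoly d A) = monicPoly d (shift d A φ) := by
  have hdeg : (Polynomial.taylor φ (monicPoly d A)).natDegree ≤ d := by
    rw [Polynomial.natDegree_taylor]
    exact natDegree_monicPoly_le d A
  have hc : (Polynomial.taylor φ (monicPoly d A)).coeff d = 1 := by
    have h := Polynomial.coeff_taylor_natDegree (r := φ) (f := monicPoly d A)
    rw [natDegree_monicPoly] at h
    rw [h, Polynomial.leadingCoeff, natDegree_monicPoly, coeff_monicPoly_self]
  exact eq_monicPoly_of_coeff d _ hdeg hc

end Shift

open MvPowerSeries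

variable {k : Type} [Field k] {m : ℕ}

/-- THE MONIC FORM IS THE EVALUATION of `monicPoly` at `Y = y = X (Fin.last m)` over the renamed plane series. -/
theorem eval₂_monicPoly {d : ℕ} (A : Fin d → MvPowerSeries (Fin m) k) :
    (monicPoly d A).eval₂
        (rename (Fin.succAboveEmb (Fin.last m)) : MvPowerSeries (Fin m) k →ₐ[k] MvPowerSeries (Fin (m + 1)) k).toRingHom
        (X (Fin.last m)) =
      X (Fin.last m) ^ d + ∑ j : Fin d, rename (Fin.succAboveEmb (Fin.last m)) (A j) * X (Fin.last m) ^ (j : ℕ) := by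
  simp only [monicPoly, Polynomial.eval₂_add, Polynomial.eval₂_X_pow, Polynomial.eval₂_finsetSum, Polynomial.eval₂_mul,
    Polynomial.eval₂_C, AlgHom.toRingHom_eq_coe, RingHom.coe_coe]

/-- THE RE-CENTRED MONIC FORM (every characteristic, every degree): for `φ ∈ k[[x']]` with `φ(0) = 0`,
`(y + φ)^d + Σ_j A_j (y + φ)^j = y^d + Σ_j (shift d A φ)_j y^j` under the shear `(x', y + φ(x'))`. -/
theorem subst_shear_monicForm {d : ℕ} (φ : MvPowerSeries (Fin m) k) (hφ : constantCoeff φ = 0)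
    (A : Fin d → MvPowerSeries (Fin m) k) :
    subst (fun l : Fin (m + 1) => if l = Fin.last m then X (Fin.last m) + rename (Fin.succAboveEmb (Fin.last m)) φ else X l)
        (X (Fin.last m) ^ d + ∑ j : Fin d, rename (Fin.succAboveEmb (Fin.last m)) (A j) * X (Fin.last m) ^ (j : ℕ)) =
      X (Fin.last m) ^ d + ∑ j : Fin d, rename (Fin.succAboveEmb (Fin.last m)) (shift d A φ j) * X (Fin.last m) ^ (j : ℕ) := by
  have h0 : ∀ l, constantCoeff ((fun l : Fin (m + 1) => if l = Fin.last m
      then X (Fin.last m) + rename (Fin.succAboveEmb (Fin.last m)) φ else X l) l) = 0 := by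
    intro l
    dsimp only
    split_ifs
    · rw [map_add, constantCoeff_X, constantCoeff_rename, hφ, add_zero]
    · exact constantCoeff_X l
  have hs := hasSubst_of_constantCoeff_zero h0
  set f : MvPowerSeries (Fin m) k →+* MvPowerSeries (Fin (m + 1)) k :=
    (rename (Fin.succAboveEmb (Fin.last m)) : MvPowerSeries (Fin m) k →ₐ[k] MvPowerSeries (Fin (m + 1)) k).toRingHom
    with hf
  rw [← eval₂_monicPoly A, ← eval₂_monicPoly (shift d A φ), ← taylor_monicPoly, ← coe_substAlgHom hs]
  have hcomp : (substAlgHom (R := k) hs).toRingHom.comp f = f := by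
    refine RingHom.ext fun a => ?_
    rw [RingHom.comp_apply, hf, AlgHom.toRingHom_eq_coe, AlgHom.coe_toRingHom, AlgHom.toRingHom_eq_coe,
      AlgHom.coe_toRingHom, coe_substAlgHom]
    exact MonicRecentre.subst_shear_rename φ hφ a
  have hY : (substAlgHom (R := k) hs).toRingHom (X (Fin.last m)) = X (Fin.last m) + f φ := by
    rw [AlgHom.toRingHom_eq_coe, AlgHom.coe_toRingHom, coe_substAlgHom, subst_X hs, hf, AlgHom.toRingHom_eq_coe,
      AlgHom.coe_toRingHom]
    exact if_pos rfl
  have h1 : (substAlgHom (R := k) hs) ((monicPoly d A).eval₂ f (X (Fin.last m))) =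
      (monicPoly d A).eval₂ ((substAlgHom (R := k) hs).toRingHom.comp f) ((substAlgHom (R := k) hs).toRingHom (X (Fin.last m))) := by
    rw [← Polynomial.hom_eval₂]
    rfl
  rw [h1, hcomp, hY, Polynomial.taylor_apply, Polynomial.eval₂_comp, Polynomial.eval₂_add, Polynomial.eval₂_X,
    Polynomial.eval₂_C]


/-- RE-CENTRING IS A FREE MOVE (every characteristic, every degree `d`, every dimension `m + 1`): for `φ ∈ k[[x']]` with
`φ(0) = 0`, the monic form of the shifted tuple `shift d A φ` is won iff the monic form of `A` is — the shear
`(x', y + φ(x'))` is a legal coordinate change (`won_subst_iff`).  Degree-`2` instance: `won_monic_two_recentre_iff`. -/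
theorem won_monic_recentre_iff {d : ℕ} (φ : MvPowerSeries (Fin m) k) (hφ : constantCoeff φ = 0)
    (A : Fin d → MvPowerSeries (Fin m) k) :
    CobordantGame.Won k (m + 1) (X (Fin.last m) ^ d +
        ∑ j : Fin d, rename (Fin.succAboveEmb (Fin.last m)) (shift d A φ j) * X (Fin.last m) ^ (j : ℕ)) ↔
      CobordantGame.Won k (m + 1) (X (Fin.last m) ^ d +
        ∑ j : Fin d, rename (Fin.succAboveEmb (Fin.last m)) (A j) * X (Fin.last m) ^ (j : ℕ)) := by
  classical
  obtain ⟨τ, hτ⟩ : ∃ τ : Fin (m + 1) → MvPowerSeries (Fin (m + 1)) k,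
      ∀ l, τ l = if l = Fin.last m then X (Fin.last m) + rename (Fin.succAboveEmb (Fin.last m)) φ else X l :=
    ⟨_, fun _ => rfl⟩
  have hτeq : τ = fun l : Fin (m + 1) => if l = Fin.last m
      then X (Fin.last m) + rename (Fin.succAboveEmb (Fin.last m)) φ else X l := funext hτ
  have hτ0 : ∀ l, constantCoeff (τ l) = 0 := by
    intro l
    rw [hτ]
    split_ifs
    · rw [map_add, constantCoeff_X, constantCoeff_rename, hφ, add_zero]
    · exact constantCoeff_X l
  have hc1 : coeff (Finsupp.single (Fin.last m) 1) (rename (Fin.succAboveEmb (Fin.last m)) φ) = 0 := by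
    have h := TschirnhausForm.coeff_emb_add_single_rename (m := m) (0 : Fin m →₀ ℕ) 1 φ
    rw [Finsupp.embDomain_zero, zero_add, if_neg one_ne_zero] at h
    exact h
  have hτdet : IsUnit (FormalCoordChange.linMat τ).det := by
    rw [FormalCoordChange.linMat, TschirnhausForm.det_of_offLast_rows]
    · rw [Matrix.of_apply, hτ, if_pos rfl, map_add, coeff_index_single_self_X, hc1, add_zero]
      exact isUnit_one
    · intro l j hl
      rw [Matrix.of_apply, hτ, if_neg hl, coeff_index_single_X]
  rw [← subst_shear_monicForm φ hφ A, ← hτeq]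
  exact won_subst_iff hτ0 hτdet _

/-- A COORDINATE CHANGE OF THE PLANE EXTENDED BY `y ↦ y` acts on a monic form coefficientwise:
`(y^d + Σ A_j y^j) ∘ θ̃ = y^d + Σ (A_j ∘ θ) y^j`. -/
theorem subst_extendLast_monicForm {d : ℕ} (θ : Fin m → MvPowerSeries (Fin m) k) (hθ : ∀ i, constantCoeff (θ i) = 0)
    (A : Fin d → MvPowerSeries (Fin m) k) :
    subst (fun l : Fin (m + 1) => Fin.lastCases (motive := fun _ => MvPowerSeries (Fin (m + 1)) k) (X (Fin.last m))
        (fun i => rename (Fin.succAboveEmb (Fin.last m)) (θ i)) l)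
        (X (Fin.last m) ^ d + ∑ j : Fin d, rename (Fin.succAboveEmb (Fin.last m)) (A j) * X (Fin.last m) ^ (j : ℕ)) =
      X (Fin.last m) ^ d +
        ∑ j : Fin d, rename (Fin.succAboveEmb (Fin.last m)) (subst θ (A j)) * X (Fin.last m) ^ (j : ℕ) := by
  have hs := hasSubst_of_constantCoeff_zero (WildPurePower.constantCoeff_extendLast θ hθ)
  have hY : subst (fun l : Fin (m + 1) => Fin.lastCases (motive := fun _ => MvPowerSeries (Fin (m + 1)) k) (X (Fin.last m))
      (fun i => rename (Fin.succAboveEmb (Fin.last m)) (θ i)) l) (X (Fin.last m) : MvPowerSeries (Fin (m + 1)) k) =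
      X (Fin.last m) := by
    rw [subst_X hs]
    exact Fin.lastCases_last
  rw [← coe_substAlgHom hs]
  simp only [map_add, map_pow, map_sum, map_mul, coe_substAlgHom, hY, WildPurePower.subst_extendLast_rename θ hθ]

/-- COORDINATE CHANGES OF THE PLANE ARE FREE MOVES (every characteristic, every degree): for `θ` a coordinate change of
`k[[x']]` (zero constant terms, invertible linear part), the monic form of `(A_j ∘ θ)_j` is won iff that of `A` is. -/
theorem won_monic_substX_iff {d : ℕ} (θ : Fin m → MvPowerSeries (Fin m) k) (hθ : ∀ i, constantCoeff (θ i) = 0)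
    (hθdet : IsUnit (FormalCoordChange.linMat θ).det) (A : Fin d → MvPowerSeries (Fin m) k) :
    CobordantGame.Won k (m + 1) (X (Fin.last m) ^ d +
        ∑ j : Fin d, rename (Fin.succAboveEmb (Fin.last m)) (subst θ (A j)) * X (Fin.last m) ^ (j : ℕ)) ↔
      CobordantGame.Won k (m + 1) (X (Fin.last m) ^ d +
        ∑ j : Fin d, rename (Fin.succAboveEmb (Fin.last m)) (A j) * X (Fin.last m) ^ (j : ℕ)) := by
  rw [← subst_extendLast_monicForm θ hθ A]
  exact won_subst_iff (WildPurePower.constantCoeff_extendLast θ hθ)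
    (by rw [WildPurePower.linMat_extendLast_det]; exact hθdet) _

end WildMonic

end Summit.ResolutionOfSingularities.ResolutionOfSingularities.Theorems
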